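import Literature.AlgebraicGeometry.ModuliOfAbelianVarieties.SiegelModuliDatum
import Literature.NumberTheory.ModularForms.SiegelUpperHalfSpaceAction
import Mathlib.NumberTheory.NumberField.AdeleRing
import Mathlib.LinearAlgebra.SymplecticGroup
import HarnessLib

/-!
# The symplectic similitude group `GSp(E)` of an alternating form over a commutative ring, its
# `ℚ` / `𝔸_f` / `ℝ` points for the type-`δ` form `E_δ`, and the Siegel double space `𝔥_g^±`

Topic `AlgebraicGeometry/ModuliOfAbelianVarieties`; namespace `Literature.AlgebraicGeometry.ModuliOfAbelianVarieties`
(vocabulary of `SiegelModuliDatum`: `typeForm δ = (0 Δ; -Δ 0)`, `symplecticLatticeGroup δ = Sp_δ(ℤ)`,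
`siegelLevelGroup δ N = Γ_δ(N)`; and of `NumberTheory.ModularForms.SiegelUpperHalfSpaceAction`: the Möbius map
`moeb P Z = (αZ + β)(γZ + δ)⁻¹`).  DEFINITIONS WITH BODIES and their bookkeeping lemmas ONLY: no named fact, no
instance, no notation, no `sorry` (D-0014, typer lint).  Cell hodgecm-mathlib (D-0151), hDel line, leaf I-1′, layer
(σ1) of the RECEPTACLE PLAN `B-plan/I1prime-RECEPTACLE-PLAN.md` (B-plan2, PIN-B): the group `GSp_{2g}` of the Siegel
Shimura datum `(GSp(V, ψ), S^±)` whose Shimura variety is the Siegel modular variety — the ambient receptacle of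
[Deligne 1971] Exemple 5.8 / [Deligne 1979] 2.3.10 for Hodge-type data.  HC_CM is proved only modulo the 7 printed
citations until rung 0 closes; this file is banked vocabulary toward the I-1′ receptacle and changes no floor count.

## The mathematics (printed)

[Milne2005ShimuraVarieties] §6 «The Siegel modular variety», p. 67: for a symplectic space `(V, ψ)` over `ℚ`,
«let `GSp(ψ)` be the group of symplectic similitudes … `GSp(ψ)(k) = {g ∈ GL(V)(k) | ψ(gu, gv) = ν(g)·ψ(u, v)
for some `ν(g) ∈ k^×`}`», `Sp(ψ) = Ker ν`, and (p. 70) «The Siegel modular variety attached to `(V, ψ)` is the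
Shimura variety `Sh(G, X)`» with `G = GSp(ψ)`, `X = X⁺ ⊔ X⁻` the Siegel double space.  [Deligne1971TravauxShimura]
1.6 / 4.16 Exemple I p. 150 (the datum `(Gp(V), h₀)` = `(CSp(V), S^±)`), [Deligne1979ShimuraVarieties] 1.3.1
(«`S^±` … the Siegel double space»).  In coordinates of a symplectic basis of type `δ` the form is the tree's
`E_δ = typeForm δ`, so `GSp_δ(R) = {M ∈ GL_{2g}(R) | Mᵀ E_δ M = ν E_δ, ν ∈ R^×}` for every commutative ring `R`
([GenestierNgo2020] §1.2–1.3, §2.1: the `ℤ`-group scheme of symplectic similitudes of `(U, E)`).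

## Main definitions (all with bodies)

* `similitudeGroupOfForm E` — `GSp(E)(R) ≤ GL_n(R)` for ANY square matrix `E` over a commutative ring `R`
  (`∃ ν ∈ R^×, gᵀ E g = ν • E`); `IsMultiplier E g ν`; `symplecticGroupOfForm E` (`ν = 1`), with
  `symplecticGroupOfForm_le_similitudeGroupOfForm`, consistency `symplecticLatticeGroup_eq_symplecticGroupOfForm`
  (the tree's `Sp_δ(ℤ)`) and `mem_symplecticGroupOfForm_J_iff` (Mathlib's `Matrix.symplecticGroup`).
* functoriality in the ring: `map_mem_similitudeGroupOfForm`, `similitudeGroupOfFormMap f` (+ continuity), scalars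
  `scalar_mem_similitudeGroupOfForm` (multiplier `u²`).
* the type-`δ` points `gspRational δ = GSp_δ(ℚ)`, `gspFinAdelic δ = GSp_δ(𝔸_{ℚ,f})` (over the tree's adèle currency
  `FiniteAdeleRing (𝓞 ℚ) ℚ`), `gspReal δ = GSp_δ(ℝ)`, and the structure maps `gspRationalToFinAdelic δ`,
  `gspRationalToReal δ` (diagonal embeddings, = `GL_{2g}` of the algebra maps).
* `siegelDoubleSpace g = 𝔥_g^± = 𝔥_g ⊔ (-𝔥_g)` (symmetric `Z` with `Im Z` definite of either sign).

## Not here (next layers of the plan)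
(σ2) the adelic Siegel Shimura set `GSp(ℚ)∖(𝔥_g^± × GSp(𝔸_f)/K(N))` over the tree's generic `ShimuraDissection`
(`Through`, `CosetSpace`) and the `GSp_δ(ℝ)`-action on `𝔥_g^±` by `moeb` (closure under similitudes of either sign:
reduce to ★ `SiegelUpperHalfSpace.moeb_mem` for `Sp_{2g}(ℝ)` through the type conjugation ★ `sigmaD` and the
sign swap `Z ↦ -Z`); (σ3) the complex record of the Siegel tower; (σ4) the `E₀`-structure with the modular Galois
property ([Milne ISV] Prop. 14.12).  Related but different objects already in the tree: `Motives.Polarization.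
lefschetzSimilitudeGroupBaseChange` (similitudes of a polarised HODGE STRUCTURE, as abstract linear automorphisms),
`UnitaryShimuraHomomorphisms` (the unitary similitude factor of RSZ), ★ `spD δ` (the real symplectic group of `E_δ` as
a `Set` of matrices).

## References
* [Milne2005ShimuraVarieties] J. S. Milne, *Introduction to Shimura varieties* (2005), §6 pp. 67–70 (GSp, the Siegel
  double space, the Siegel modular variety).
* [Deligne1971TravauxShimura] P. Deligne, *Travaux de Shimura*, Sém. Bourbaki 389 (1971), 1.6, 4.16 p. 150.
* [Deligne1979ShimuraVarieties] P. Deligne, *Variétés de Shimura* (1979), 1.3.1, 2.3.10.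
* [GenestierNgo2020] A. Genestier, B. C. Ngô, *Lectures on Shimura varieties*, §1.2–1.3, §2.1.
-/

set_option autoImplicit false

noncomputable section

open Matrix Topology NumberField IsDedekindDomain

namespace Literature.AlgebraicGeometry.ModuliOfAbelianVarieties

open Literature.NumberTheory.Automorphic (siegelUpperHalfSpace mem_siegelUpperHalfSpace_iff)

/-! ### §1. `GSp(E)(R)` and `Sp(E)(R)` for a square matrix `E` over a commutative ring `R` -/

section General

variable {R S : Type*} [CommRing R] [CommRing S] {n : Type*} [Fintype n] [DecidableEq n]

/-- `ν ∈ R^×` is a **multiplier** of `g ∈ GL_n(R)` for the form with Gram matrix `E`: `gᵀ E g = ν • E`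
(`ψ(gu, gv) = ν ψ(u, v)`). [cite: Milne2005ShimuraVarieties, §6 p. 67 (definition of GSp(ψ) and ν(g))] -/
def IsMultiplier (E : Matrix n n R) (g : GL n R) (ν : Rˣ) : Prop :=
  (g : Matrix n n R)ᵀ * E * (g : Matrix n n R) = (ν : R) • E

/-- Unfolding of `IsMultiplier`. [cite: Milne2005ShimuraVarieties, §6 p. 67] -/
theorem isMultiplier_iff {E : Matrix n n R} {g : GL n R} {ν : Rˣ} :
    IsMultiplier E g ν ↔ (g : Matrix n n R)ᵀ * E * (g : Matrix n n R) = (ν : R) • E :=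
  Iff.rfl

/-- Multipliers multiply: `ν(gh) = ν(g) ν(h)`. [cite: Milne2005ShimuraVarieties, §6 p. 67 («ν is a homomorphism»)] -/
theorem IsMultiplier.mul {E : Matrix n n R} {g h : GL n R} {ν μ : Rˣ} (hg : IsMultiplier E g ν)
    (hh : IsMultiplier E h μ) : IsMultiplier E (g * h) (ν * μ) := by
  rw [isMultiplier_iff] at hg hh ⊢
  rw [Units.val_mul, Matrix.transpose_mul, Units.val_mul]
  calc (h : Matrix n n R)ᵀ * (g : Matrix n n R)ᵀ * E * ((g : Matrix n n R) * (h : Matrix n n R))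
      = (h : Matrix n n R)ᵀ * ((g : Matrix n n R)ᵀ * E * (g : Matrix n n R)) * (h : Matrix n n R) := by
        simp only [Matrix.mul_assoc]
    _ = (ν : R) • ((h : Matrix n n R)ᵀ * E * (h : Matrix n n R)) := by
        rw [hg, Matrix.mul_smul, Matrix.smul_mul]
    _ = ((ν : R) * (μ : R)) • E := by rw [hh, smul_smul]

/-- The identity has multiplier `1`. [cite: Milne2005ShimuraVarieties, §6 p. 67] -/
theorem IsMultiplier.one (E : Matrix n n R) : IsMultiplier E 1 1 := by
  rw [isMultiplier_iff, Units.val_one, Units.val_one, Matrix.transpose_one, Matrix.one_mul, Matrix.mul_one,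
    one_smul]

/-- Inverses have inverse multipliers. [cite: Milne2005ShimuraVarieties, §6 p. 67] -/
theorem IsMultiplier.inv {E : Matrix n n R} {g : GL n R} {ν : Rˣ} (hg : IsMultiplier E g ν) :
    IsMultiplier E g⁻¹ ν⁻¹ := by
  rw [isMultiplier_iff] at hg ⊢
  have h1 : (((g⁻¹ : GL n R) : Matrix n n R))ᵀ * (g : Matrix n n R)ᵀ = 1 := by
    rw [← Matrix.transpose_mul, ← Units.val_mul, mul_inv_cancel, Units.val_one, Matrix.transpose_one]
  have hE : E = ((ν⁻¹ : Rˣ) : R) • ((g : Matrix n n R)ᵀ * E * (g : Matrix n n R)) := by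
    rw [hg, smul_smul, Units.inv_mul, one_smul]
  calc ((g⁻¹ : GL n R) : Matrix n n R)ᵀ * E * ((g⁻¹ : GL n R) : Matrix n n R)
      = ((g⁻¹ : GL n R) : Matrix n n R)ᵀ * (((ν⁻¹ : Rˣ) : R) • ((g : Matrix n n R)ᵀ * E * (g : Matrix n n R))) *
          ((g⁻¹ : GL n R) : Matrix n n R) := by rw [← hE]
    _ = ((ν⁻¹ : Rˣ) : R) • ((((g⁻¹ : GL n R) : Matrix n n R)ᵀ * (g : Matrix n n R)ᵀ) * E *
          ((g : Matrix n n R) * ((g⁻¹ : GL n R) : Matrix n n R))) := by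
        rw [Matrix.mul_smul, Matrix.smul_mul]
        simp only [Matrix.mul_assoc]
    _ = ((ν⁻¹ : Rˣ) : R) • E := by
        rw [h1, ← Units.val_mul, mul_inv_cancel, Units.val_one, Matrix.one_mul, Matrix.mul_one]

/-- The **symplectic similitude group `GSp(E)(R)`** of the square matrix `E` (Gram matrix of a bilinear form)
over a commutative ring `R`: the `g ∈ GL_n(R)` with `gᵀ E g = ν • E` for SOME unit `ν` ([Milne ISV] §6:
«`GSp(ψ)(k) = {g ∈ GL(V)(k) | ψ(gu, gv) = ν(g)ψ(u, v) some ν(g) ∈ k^×}`»).  A subgroup for every `E`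
(no non-degeneracy needed).  For `E = typeForm δ` (base-changed to `R`) this is `GSp_δ(R)`, the `R`-points of the
`ℤ`-group scheme of symplectic similitudes of type `δ`. [cite: Milne2005ShimuraVarieties, §6 p. 67]
[cite: GenestierNgo2020, §2.1 (the group of symplectic similitudes)] -/
def similitudeGroupOfForm (E : Matrix n n R) : Subgroup (GL n R) where
  carrier := {g | ∃ ν : Rˣ, IsMultiplier E g ν}
  one_mem' := ⟨1, IsMultiplier.one E⟩
  mul_mem' := by
    rintro g h ⟨ν, hν⟩ ⟨μ, hμ⟩
    exact ⟨ν * μ, hν.mul hμ⟩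
  inv_mem' := by
    rintro g ⟨ν, hν⟩
    exact ⟨ν⁻¹, hν.inv⟩

/-- Membership in `GSp(E)(R)`: some unit multiplier. [cite: Milne2005ShimuraVarieties, §6 p. 67] -/
theorem mem_similitudeGroupOfForm_iff {E : Matrix n n R} {g : GL n R} :
    g ∈ similitudeGroupOfForm E ↔ ∃ ν : Rˣ, (g : Matrix n n R)ᵀ * E * (g : Matrix n n R) = (ν : R) • E :=
  Iff.rfl

/-- The **symplectic group `Sp(E)(R)`** of the form `E`: `gᵀ E g = E` (multiplier `1`; [Milne ISV] §6
«`Sp(ψ)(k) = {g ∈ GL(V)(k) | ψ(gu, gv) = ψ(u, v)}` … `Sp(ψ) = Ker(ν)`»). [cite: Milne2005ShimuraVarieties, §6 p. 67] -/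
def symplecticGroupOfForm (E : Matrix n n R) : Subgroup (GL n R) where
  carrier := {g | IsMultiplier E g 1}
  one_mem' := IsMultiplier.one E
  mul_mem' {g h} hg hh := by
    have := hg.mul hh
    rwa [mul_one] at this
  inv_mem' {g} hg := by
    have := hg.inv
    rwa [inv_one] at this

/-- Membership in `Sp(E)(R)`: `gᵀ E g = E`. [cite: Milne2005ShimuraVarieties, §6 p. 67] -/
theorem mem_symplecticGroupOfForm_iff {E : Matrix n n R} {g : GL n R} :
    g ∈ symplecticGroupOfForm E ↔ (g : Matrix n n R)ᵀ * E * (g : Matrix n n R) = E := by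
  change IsMultiplier E g 1 ↔ _
  rw [isMultiplier_iff, Units.val_one, one_smul]

/-- `Sp(E) ≤ GSp(E)`. [cite: Milne2005ShimuraVarieties, §6 p. 67 («Sp(ψ) = Ker(ν)»)] -/
theorem symplecticGroupOfForm_le_similitudeGroupOfForm (E : Matrix n n R) :
    symplecticGroupOfForm E ≤ similitudeGroupOfForm E :=
  fun _ hg => ⟨1, hg⟩

/-- **Scalars are similitudes**: `u • 1 ∈ GSp(E)(R)` with multiplier `u²`, for every unit `u`
(the centre `𝔾_m ⊂ GSp`). [cite: Milne2005ShimuraVarieties, §6 p. 67] [cite: Deligne1971TravauxShimura, 1.6 p. 128] -/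
theorem scalar_isMultiplier (E : Matrix n n R) (u : Rˣ) :
    IsMultiplier E (Units.map (Matrix.scalar n : R →+* Matrix n n R).toMonoidHom u) (u * u) := by
  rw [isMultiplier_iff]
  have hcoe : ((Units.map (Matrix.scalar n : R →+* Matrix n n R).toMonoidHom u : GL n R) : Matrix n n R) =
      (u : R) • (1 : Matrix n n R) := by
    simp [Matrix.scalar_apply, Matrix.smul_one_eq_diagonal]
  rw [hcoe, Matrix.transpose_smul, Matrix.transpose_one, Matrix.smul_mul, Matrix.one_mul, Matrix.mul_smul,
    Matrix.mul_one, smul_smul, Units.val_mul]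

/-- Scalars lie in `GSp(E)(R)`. [cite: Milne2005ShimuraVarieties, §6 p. 67] -/
theorem scalar_mem_similitudeGroupOfForm (E : Matrix n n R) (u : Rˣ) :
    Units.map (Matrix.scalar n : R →+* Matrix n n R).toMonoidHom u ∈ similitudeGroupOfForm E :=
  ⟨u * u, scalar_isMultiplier E u⟩

/-- **Functoriality in the ring**: `GL_n(f)` maps `GSp(E)(R)` into `GSp(f E)(S)`, multipliers going to their
images (apply `f` entrywise to `gᵀ E g = ν E`).  This is how `GSp(ℚ) → GSp(𝔸_f)` and `GSp(ℚ) → GSp(ℝ)` arise.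
[cite: GenestierNgo2020, §2.1 (GSp as a group scheme: points functorial in the ring)] -/
theorem IsMultiplier.map (f : R →+* S) {E : Matrix n n R} {g : GL n R} {ν : Rˣ} (hg : IsMultiplier E g ν) :
    IsMultiplier (E.map f) (Matrix.GeneralLinearGroup.map f g) (Units.map f.toMonoidHom ν) := by
  rw [isMultiplier_iff] at hg ⊢
  have hfg : ((Matrix.GeneralLinearGroup.map f g : GL n S) : Matrix n n S) = (g : Matrix n n R).map f := rfl
  rw [hfg, ← Matrix.transpose_map, ← Matrix.map_mul, ← Matrix.map_mul, hg]
  ext i j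
  simp [Matrix.map_apply, Matrix.smul_apply]

/-- `GL_n(f)` maps `GSp(E)(R)` into `GSp(f E)(S)`. [cite: GenestierNgo2020, §2.1] -/
theorem map_mem_similitudeGroupOfForm (f : R →+* S) {E : Matrix n n R} {g : GL n R}
    (hg : g ∈ similitudeGroupOfForm E) :
    Matrix.GeneralLinearGroup.map f g ∈ similitudeGroupOfForm (E.map f) := by
  obtain ⟨ν, hν⟩ := hg
  exact ⟨Units.map f.toMonoidHom ν, hν.map f⟩

/-- `GL_n(f)` maps `Sp(E)(R)` into `Sp(f E)(S)`. [cite: GenestierNgo2020, §2.1] -/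
theorem map_mem_symplecticGroupOfForm (f : R →+* S) {E : Matrix n n R} {g : GL n R}
    (hg : g ∈ symplecticGroupOfForm E) :
    Matrix.GeneralLinearGroup.map f g ∈ symplecticGroupOfForm (E.map f) := by
  have h := IsMultiplier.map f (show IsMultiplier E g 1 from hg)
  rwa [map_one] at h

/-- The homomorphism `GSp(E)(R) →* GSp(f E)(S)` induced by `f : R →+* S` (restriction of `GL_n(f)`).
[cite: GenestierNgo2020, §2.1] -/
def similitudeGroupOfFormMap (f : R →+* S) (E : Matrix n n R) :
    similitudeGroupOfForm E →* similitudeGroupOfForm (E.map f) :=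
  ((Matrix.GeneralLinearGroup.map f).restrict (similitudeGroupOfForm E)).codRestrict _
    fun g => map_mem_similitudeGroupOfForm f g.2

/-- `similitudeGroupOfFormMap f E g = GL_n(f) g` on underlying invertible matrices. [cite: GenestierNgo2020, §2.1] -/
@[simp] theorem coe_similitudeGroupOfFormMap (f : R →+* S) (E : Matrix n n R) (g : similitudeGroupOfForm E) :
    (similitudeGroupOfFormMap f E g : GL n S) = Matrix.GeneralLinearGroup.map f g := rfl

/-- `similitudeGroupOfFormMap` is continuous for the unit-group topologies when `f` is. [cite: GenestierNgo2020, §2.1] -/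
theorem continuous_similitudeGroupOfFormMap [TopologicalSpace R] [IsTopologicalRing R]
    [TopologicalSpace S] [IsTopologicalRing S] (f : R →+* S) (E : Matrix n n R) (hc : Continuous f) :
    Continuous (similitudeGroupOfFormMap f E) :=
  Continuous.subtype_mk (hc.generalLinearGroup_map.comp continuous_subtype_val) _

end General

/-! ### §2. Consistency with the tree's `Sp_δ(ℤ)` and with Mathlib's `Matrix.symplecticGroup` -/

section Consistency

variable {g : ℕ}

/-- The tree's arithmetic group `Sp_δ(ℤ)` (`symplecticLatticeGroup δ`) IS `Sp(E_δ)(ℤ)` in the present sense.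
[cite: GenestierNgo2020, §1.2 (the group Sp_D(ℤ))] -/
theorem symplecticLatticeGroup_eq_symplecticGroupOfForm (δ : Fin g → ℕ) :
    symplecticLatticeGroup δ = symplecticGroupOfForm (typeForm δ) := by
  ext M
  rw [mem_symplecticLatticeGroup_iff, mem_symplecticGroupOfForm_iff]

/-- Mathlib's `Matrix.symplecticGroup l R` (the matrices `A` with `A J Aᵀ = J`, `J = (0 -1; 1 0)`) and the present
`Sp(J)(R)` have the same invertible elements: for `A ∈ GL_{2l}(R)`, `A ∈ symplecticGroupOfForm (J l R) ↔
(A : Matrix) ∈ Matrix.symplecticGroup l R` (Mathlib `SymplecticGroup.mem_iff'`: `Aᵀ J A = J`).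
[cite: Milne2005ShimuraVarieties, §6 p. 67] -/
theorem mem_symplecticGroupOfForm_J_iff {R : Type*} [CommRing R] {l : Type*} [Fintype l] [DecidableEq l]
    (A : GL (l ⊕ l) R) :
    A ∈ symplecticGroupOfForm (Matrix.J l R) ↔ (A : Matrix (l ⊕ l) (l ⊕ l) R) ∈ Matrix.symplecticGroup l R := by
  rw [mem_symplecticGroupOfForm_iff, SymplecticGroup.mem_iff']

end Consistency

/-! ### §3. The type-`δ` similitude groups over `ℚ`, `𝔸_{ℚ,f}`, `ℝ` and their structure maps -/

section Points

variable {g : ℕ}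

/-- The type-`δ` Gram matrix over a commutative ring `R` (`E_δ` with integer entries cast to `R`).
[cite: GenestierNgo2020, §1.2 (symplectic basis of type D)] -/
def typeFormOver (δ : Fin g → ℕ) (R : Type*) [CommRing R] : Matrix (Fin g ⊕ Fin g) (Fin g ⊕ Fin g) R :=
  (typeForm δ).map (Int.castRingHom R)

/-- `typeFormOver δ R` is `E_δ` cast entrywise (definitional). [cite: GenestierNgo2020, §1.2] -/
theorem typeFormOver_apply (δ : Fin g → ℕ) (R : Type*) [CommRing R] (i j : Fin g ⊕ Fin g) :
    typeFormOver δ R i j = ((typeForm δ i j : ℤ) : R) := rfl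

/-- A ring homomorphism carries `E_δ` over `R` to `E_δ` over `S` (integer entries). [cite: GenestierNgo2020, §1.2] -/
theorem typeFormOver_map {R S : Type*} [CommRing R] [CommRing S] (δ : Fin g → ℕ) (f : R →+* S) :
    (typeFormOver δ R).map f = typeFormOver δ S := by
  ext i j
  simp [typeFormOver_apply]

/-- **`GSp_δ(ℚ)`**, the rational points of the Siegel datum's group. [cite: Milne2005ShimuraVarieties, §6 p. 67, p. 70]
[cite: Deligne1971TravauxShimura, 4.16 Exemple I p. 150] -/
abbrev gspRational (δ : Fin g → ℕ) : Subgroup (GL (Fin g ⊕ Fin g) ℚ) :=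
  similitudeGroupOfForm (typeFormOver δ ℚ)

/-- **`GSp_δ(𝔸_{ℚ,f})`**, the finite-adelic points (over the tree's adèle currency `FiniteAdeleRing (𝓞 ℚ) ℚ`).
[cite: Milne2005ShimuraVarieties, §5 p. 56 («Sh_K(G,X) = G(ℚ)∖X × G(𝔸_f)/K»), §6 p. 70] -/
abbrev gspFinAdelic (δ : Fin g → ℕ) : Subgroup (GL (Fin g ⊕ Fin g) (FiniteAdeleRing (𝓞 ℚ) ℚ)) :=
  similitudeGroupOfForm (typeFormOver δ (FiniteAdeleRing (𝓞 ℚ) ℚ))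

/-- **`GSp_δ(ℝ)`**, the real points (which act on the Siegel double space `𝔥_g^±`).
[cite: Milne2005ShimuraVarieties, §6 pp. 67–70] -/
abbrev gspReal (δ : Fin g → ℕ) : Subgroup (GL (Fin g ⊕ Fin g) ℝ) :=
  similitudeGroupOfForm (typeFormOver δ ℝ)

/-- The diagonal embedding **`GSp_δ(ℚ) →* GSp_δ(𝔸_{ℚ,f})`** (entrywise `ℚ → 𝔸_{ℚ,f}`).
[cite: Milne2005ShimuraVarieties, §5 p. 56] -/
def gspRationalToFinAdelic (δ : Fin g → ℕ) : gspRational δ →* gspFinAdelic δ :=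
  ((Matrix.GeneralLinearGroup.map (algebraMap ℚ (FiniteAdeleRing (𝓞 ℚ) ℚ))).restrict (gspRational δ)).codRestrict _
    fun x => by
      have h := map_mem_similitudeGroupOfForm (algebraMap ℚ (FiniteAdeleRing (𝓞 ℚ) ℚ)) x.2
      rwa [typeFormOver_map] at h

/-- `gspRationalToFinAdelic` is `GL_{2g}` of the algebra map on matrices. [cite: Milne2005ShimuraVarieties, §5 p. 56] -/
@[simp] theorem coe_gspRationalToFinAdelic (δ : Fin g → ℕ) (x : gspRational δ) :
    (gspRationalToFinAdelic δ x : GL (Fin g ⊕ Fin g) (FiniteAdeleRing (𝓞 ℚ) ℚ)) =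
      Matrix.GeneralLinearGroup.map (algebraMap ℚ (FiniteAdeleRing (𝓞 ℚ) ℚ)) x := rfl

/-- The embedding **`GSp_δ(ℚ) →* GSp_δ(ℝ)`** (entrywise `ℚ → ℝ`). [cite: Milne2005ShimuraVarieties, §5 p. 56, §6 p. 70] -/
def gspRationalToReal (δ : Fin g → ℕ) : gspRational δ →* gspReal δ :=
  ((Matrix.GeneralLinearGroup.map (algebraMap ℚ ℝ)).restrict (gspRational δ)).codRestrict _
    fun x => by
      have h := map_mem_similitudeGroupOfForm (algebraMap ℚ ℝ) x.2
      rwa [typeFormOver_map] at h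

/-- `gspRationalToReal` is `GL_{2g}` of the cast `ℚ → ℝ` on matrices. [cite: Milne2005ShimuraVarieties, §5 p. 56] -/
@[simp] theorem coe_gspRationalToReal (δ : Fin g → ℕ) (x : gspRational δ) :
    (gspRationalToReal δ x : GL (Fin g ⊕ Fin g) ℝ) = Matrix.GeneralLinearGroup.map (algebraMap ℚ ℝ) x := rfl

/-- `Sp_δ(ℤ) → GSp_δ(ℚ)`: integral symplectic matrices are rational similitudes (multiplier `1`); in particular
every `Γ_δ(N)` maps into `GSp_δ(ℚ)`. [cite: GenestierNgo2020, §1.2–1.3] -/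
theorem map_mem_gspRational_of_mem_symplecticLatticeGroup (δ : Fin g → ℕ) {M : GL (Fin g ⊕ Fin g) ℤ}
    (hM : M ∈ symplecticLatticeGroup δ) :
    Matrix.GeneralLinearGroup.map (Int.castRingHom ℚ) M ∈ gspRational δ := by
  rw [symplecticLatticeGroup_eq_symplecticGroupOfForm] at hM
  exact symplecticGroupOfForm_le_similitudeGroupOfForm _ (map_mem_symplecticGroupOfForm (Int.castRingHom ℚ) hM)

/-- Non-vacuity: the scalar `u • 1`, `u ∈ ℚ^×`, is a rational similitude of type `δ` (multiplier `u²`).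
[cite: Milne2005ShimuraVarieties, §6 p. 67] -/
theorem scalar_mem_gspRational (δ : Fin g → ℕ) (u : ℚˣ) :
    Units.map (Matrix.scalar (Fin g ⊕ Fin g) : ℚ →+* Matrix (Fin g ⊕ Fin g) (Fin g ⊕ Fin g) ℚ).toMonoidHom u ∈
      gspRational δ :=
  scalar_mem_similitudeGroupOfForm _ u

end Points

/-! ### §4. The Siegel double space `𝔥_g^±` -/

section DoubleSpace

variable {g : ℕ}

/-- The **Siegel double space `𝔥_g^± = 𝔥_g ⊔ 𝔥_g⁻`**: complex symmetric `g × g` matrices whose imaginary part is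
positive OR negative definite — equivalently `Z ∈ 𝔥_g` or `-Z ∈ 𝔥_g` ([Milne ISV] §6: «the Siegel double space
… `X = X⁺ ⊔ X⁻`»; [Deligne 1979] 1.3.1 «`S^±`»).  It is the `GSp_{2g}(ℝ)`-conjugacy class of `h₀`, on which
similitudes with negative multiplier swap the two halves. [cite: Milne2005ShimuraVarieties, §6 pp. 68–70]
[cite: Deligne1979ShimuraVarieties, 1.3.1] -/
def siegelDoubleSpace (g : ℕ) : Set (Matrix (Fin g) (Fin g) ℂ) :=
  {Z | Z ∈ siegelUpperHalfSpace g ∨ -Z ∈ siegelUpperHalfSpace g}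

/-- Membership in `𝔥_g^±`. [cite: Milne2005ShimuraVarieties, §6 p. 68] -/
theorem mem_siegelDoubleSpace_iff {Z : Matrix (Fin g) (Fin g) ℂ} :
    Z ∈ siegelDoubleSpace g ↔ Z ∈ siegelUpperHalfSpace g ∨ -Z ∈ siegelUpperHalfSpace g :=
  Iff.rfl

/-- `𝔥_g ⊆ 𝔥_g^±` (the `+` half). [cite: Milne2005ShimuraVarieties, §6 p. 68] -/
theorem siegelUpperHalfSpace_subset_siegelDoubleSpace (g : ℕ) : siegelUpperHalfSpace g ⊆ siegelDoubleSpace g :=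
  fun _ hZ => Or.inl hZ

/-- `𝔥_g^±` is stable under `Z ↦ -Z` (the swap of the two halves). [cite: Milne2005ShimuraVarieties, §6 p. 68] -/
theorem neg_mem_siegelDoubleSpace {Z : Matrix (Fin g) (Fin g) ℂ} (hZ : Z ∈ siegelDoubleSpace g) :
    -Z ∈ siegelDoubleSpace g := by
  rcases hZ with h | h
  · exact Or.inr (by rwa [neg_neg])
  · exact Or.inl h

/-- The two halves are disjoint: no `Z` has both `Im Z` and `-Im Z` positive definite (for `g ≥ 1`; for `g = 0`
both sides hold vacuously, whence the hypothesis). [cite: Milne2005ShimuraVarieties, §6 p. 68 («X = X⁺ ⊔ X⁻»)] -/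
theorem not_mem_and_neg_mem_siegelUpperHalfSpace (hg : 0 < g) {Z : Matrix (Fin g) (Fin g) ℂ}
    (hZ : Z ∈ siegelUpperHalfSpace g) : -Z ∉ siegelUpperHalfSpace g := by
  intro hZ'
  haveI : Nonempty (Fin g) := ⟨⟨0, hg⟩⟩
  have hmap : (-Z).map Complex.im = -(Z.map Complex.im) :=
    Matrix.map_neg Complex.im (fun a => Complex.neg_im a) Z
  have h2 : (-(Z.map Complex.im)).PosDef := hmap ▸ hZ'.2
  have hpos : 0 < (Z.map Complex.im).trace := hZ.2.trace_pos
  have hneg : 0 < (-(Z.map Complex.im)).trace := h2.trace_pos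
  rw [Matrix.trace_neg] at hneg
  linarith

/-- Non-vacuity: `i·1_g ∈ 𝔥_g^±`. [cite: Milne2005ShimuraVarieties, §6 p. 68] -/
theorem I_smul_one_mem_siegelDoubleSpace (g : ℕ) :
    (Complex.I • (1 : Matrix (Fin g) (Fin g) ℂ)) ∈ siegelDoubleSpace g :=
  siegelUpperHalfSpace_subset_siegelDoubleSpace g (I_smul_one_mem_siegelUpperHalfSpace g)

end DoubleSpace

end Literature.AlgebraicGeometry.ModuliOfAbelianVarieties

end
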